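import Mathlib

/-!
# SoloBlind E52 — the cap lemma: a cyclic quotient `ℤ/m` cut by the further relation `n = 0` has order `gcd(m, n)`

Solo programme `solo-Langlands-blind`, own line (O1b), s118 (tower theory §13.4, "the cap by v_y(N−1) is a theorem").
If a Hecke cell has cyclic Eisenstein quotient `T/I ≅ ℤ/M′` and the modulus ideal additionally contains `U_N − N`, which on
the cell `U_N = 1` is the integer `1 − N`, then the resulting quotient is `(ℤ/M′)/(N−1) ≅ ℤ/gcd(M′, N−1)`: valuations are capped,
`v_y = min(v_y(M′), v_y(N−1))`.  The ring-theoretic content is the order count below for `ZMod m ⧸ (n)`.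

* `span_natCast_coe_eq_zmultiples` : in `ZMod m` the ideal `(n)` and the subgroup generated by `n` have the same elements;
* `card_span_natCast`               : `#(n) = m / gcd(m, n)`;
* `card_quotient_span_natCast`      : `#(ZMod m ⧸ (n)) = gcd(m, n)`.
-/

set_option linter.dupNamespace false

namespace Summit.Langlands.Langlands.Theorems.SoloBlindCyclicCap

/-- In `ZMod m` (`m ≠ 0`) the principal ideal generated by `x` has the same elements as the additive subgroup generated by `x`. -/
theorem span_coe_eq_zmultiples (m : ℕ) [NeZero m] (x : ZMod m) :
    (↑(Ideal.span ({x} : Set (ZMod m))) : Set (ZMod m)) = ↑(AddSubgroup.zmultiples x) := by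
  ext y
  rw [SetLike.mem_coe, SetLike.mem_coe, Ideal.mem_span_singleton, AddSubgroup.mem_zmultiples_iff]
  constructor
  · rintro ⟨r, rfl⟩
    refine ⟨(r.val : ℤ), ?_⟩
    rw [zsmul_eq_mul, Int.cast_natCast, ZMod.natCast_zmod_val, mul_comm]
  · rintro ⟨k, rfl⟩
    rw [zsmul_eq_mul]
    exact dvd_mul_left x _

/-- The principal ideal `(n)` of `ZMod m` has `m / gcd(m, n)` elements. -/
theorem card_span_natCast (m n : ℕ) [NeZero m] :
    Nat.card (Ideal.span ({(n : ZMod m)} : Set (ZMod m))) = m / Nat.gcd m n := by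
  have e : Nat.card (Ideal.span ({(n : ZMod m)} : Set (ZMod m))) = Nat.card (AddSubgroup.zmultiples (n : ZMod m)) :=
    Nat.card_congr (Equiv.setCongr (span_coe_eq_zmultiples m (n : ZMod m)))
  rw [e, Nat.card_zmultiples, ZMod.addOrderOf_coe _ (NeZero.ne m)]

/-- CAP LEMMA: `ZMod m ⧸ (n)` has exactly `gcd(m, n)` elements (`m ≠ 0`). -/
theorem card_quotient_span_natCast (m n : ℕ) [NeZero m] :
    Nat.card (ZMod m ⧸ Ideal.span ({(n : ZMod m)} : Set (ZMod m))) = Nat.gcd m n := by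
  have hcard := Submodule.card_eq_card_quotient_mul_card (Ideal.span ({(n : ZMod m)} : Set (ZMod m)))
  rw [Nat.card_zmod, card_span_natCast] at hcard
  have hg : Nat.gcd m n ∣ m := Nat.gcd_dvd_left m n
  have hpos : 0 < m / Nat.gcd m n :=
    Nat.div_pos (Nat.le_of_dvd (NeZero.pos m) hg) (Nat.gcd_pos_of_pos_left n (NeZero.pos m))
  have key : m / Nat.gcd m n * Nat.card (ZMod m ⧸ Ideal.span ({(n : ZMod m)} : Set (ZMod m)))
      = m / Nat.gcd m n * Nat.gcd m n := by
    rw [← hcard, Nat.div_mul_cancel hg]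
  exact Nat.eq_of_mul_eq_mul_left hpos key

/-- Valuation form used in the law: the order of the capped quotient divides both `m` and `n`. -/
theorem card_quotient_span_natCast_dvd (m n : ℕ) [NeZero m] :
    Nat.card (ZMod m ⧸ Ideal.span ({(n : ZMod m)} : Set (ZMod m))) ∣ m ∧
    Nat.card (ZMod m ⧸ Ideal.span ({(n : ZMod m)} : Set (ZMod m))) ∣ n := by
  rw [card_quotient_span_natCast]
  exact ⟨Nat.gcd_dvd_left m n, Nat.gcd_dvd_right m n⟩

end Summit.Langlands.Langlands.Theorems.SoloBlindCyclicCap
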